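import Summits.MatrixMultiplication.OmegaCensus.SmallFormats.InvertiblePointNearLineColumns
import HarnessLib

/-!
# ω-census family (a): NO-GO for wide line-column shapes at a near-frame point of `⟨2,2,n⟩`

Cell `pub-omega` (unit `pub-omega-tensor-g25`), topic `Summits/MatrixMultiplication/OmegaCensus` (sub-folder `SmallFormats`).
Framing (verbatim): lottery ticket; floor = certified bounds/negative ranges. HONEST FRAMING: an elementary structural no-go over an
arbitrary field, the unconditional companion of `near_lineColumnShape_defect_rank` (`InvertiblePointNearLineColumns`, v2): at a near-frame
point (`X₀ = 1`, `|O| = 2n + 1`, data `ρ, σ, l, j₀` of `InvertiblePointNearFrame`) a line-column shape `J` — column `j` of every `W_t`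
(`t ∉ O`) and of `W_{j₀}` on a line `k·ζ_j` for `j ∈ J` — with `|J| < n` and `|ι| + 2 ≤ 2n + 2|J|` cannot exist (`near_not_lineColumnShape_wide`).
For the `𝔽₃` `⟨2,2,6⟩ @ 20` census (`|ι| = 20`, `n = 6`): `span{W_t : t ∈ Z} + k·W_{j₀}` never lies in a space with FIVE line columns; in the
omega-law engine of tensor g25 (`OMEGA-LAW.md`) this is the case `ω(Q) = 0` of the rank-one 'heavy' functionals. Proof: the defect functionals
`e(·,W)` vanish at `1` (`nearDefect_one`), so `K₁ := K₀ ∩ {e(·,W) = 0}` has codimension `≤ 3` in `K₀ = ⋂_{t∉O} ker g_t`; its line columns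
vanish (`nearLineCol_eq`), hence `K₁ =` the matrices supported off `J` (dimension count), a nonzero `X`-stable space with exact transport
(`near_transport`), and some `f_s` would be multiplicative (`not_mul_hom_matrix_two`). Not a rank bound; nothing on `ω`.
-/

namespace Summit.MatrixMultiplication.OmegaCensus.SmallFormats

open Module Matrix Literature.Computability.AlgebraicComplexity

variable {k : Type*} [Field k] {n : ℕ} {ι : Type*} [Fintype ι]

section Wide

variable (β : BilinComp (mulBilin k 2 2 n) ι) (O : Finset ι)

/-- **NO-GO: wide line-column shapes at a near-frame point (NEAR-STRUCTURE.md §7, tensor g25).** Setting of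
`near_lineColumnShape_defect_rank` (`InvertiblePointNearLineColumns`) but with NO hypothesis on the defect form: if the line-column shape `J` (`|J| < n`) is wide enough that
`|ι| + 2 ≤ 2n + 2|J|` (census: `n = 6`, `|ι| = 20` ⇒ `|J| = 5`), it cannot occur. Reason: the defect functionals `e(·,W)` vanish at `1`
(`nearDefect_one`), so `K₁ := {W ∈ K₀ : e(·,W) = 0}` has codimension `≤ 3` in `K₀`, hence `dim K₁ ≥ 2n − |Z| − 3 ≥ 2(n − |J|)`; its line
columns vanish (`nearLineCol_eq`), so `K₁ = M₀` (the matrices supported off `J`), a nonzero `X`-stable space with exact transport — and some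
`f_s` would be multiplicative (`not_mul_hom_matrix_two`). For the `𝔽₃` `⟨2,2,6⟩ @ 20` census: `span{W_t : t ∈ Z} + k·W_{j₀}` never lies in a space
with five line columns (types `LT1+J1⁵`), which is 'case ω(Q) = 0' of the rank-one heavy ω's in `OMEGA-LAW.md`. -/
theorem near_not_lineColumnShape_wide [DecidableEq ι] (hO : ∀ i, i ∉ O → β.f i 1 = 0) (hO' : ∀ i ∈ O, β.f i 1 ≠ 0)
    (hcard : O.card = 2 * n + 1) {ρ σ l : ι → k}
    (hM : ∀ s ∈ O, ∀ j ∈ O, β.f s 1 * β.g s (β.w j) = (if s = j then 1 else 0) + ρ s * σ j)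
    (hρ : ∃ s ∈ O, ρ s ≠ 0) {j₀ : ι} (hj₀ : j₀ ∈ O) (hσ : σ j₀ ≠ 0) (hl : ∀ s ∈ O, σ s = l s * σ j₀) (hl₀ : l j₀ = 1)
    (J : Finset (Fin n)) (ζ : Fin n → Fin 2 → k) (hζ : ∀ j ∈ J, ζ j ≠ 0) (hJ : J.card < n)
    (hZ : Fintype.card ι + 2 ≤ 2 * n + 2 * J.card)
    (hT : ∀ t, t ∉ O → ∀ j ∈ J, ∃ c : k, ∀ r, β.w t r j = c * ζ j r)
    (w₀ : Fin n → k) (hQ : ∀ j ∈ J, ∀ r, β.w j₀ r j = w₀ j * ζ j r) : False := by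
  classical
  -- the defect functional `W ↦ e(X, W)` for fixed `X`, and `X ↦ e(X, W)` for fixed `W`
  let eW : Matrix (Fin 2) (Fin 2) k → Module.Dual k (Matrix (Fin 2) (Fin n) k) :=
    fun X => ∑ s ∈ O, (l s * β.f s X) • β.g s
  have heW : ∀ X W, eW X W = ∑ s ∈ O, l s * (β.f s X * β.g s W) := fun X W => by
    simp only [eW, LinearMap.coe_sum, Finset.sum_apply, LinearMap.smul_apply, smul_eq_mul, mul_assoc]
  let eX : Matrix (Fin 2) (Fin n) k → Module.Dual k (Matrix (Fin 2) (Fin 2) k) :=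
    fun W => ∑ s ∈ O, (l s * β.g s W) • β.f s
  have heX : ∀ X W, eX W X = ∑ s ∈ O, l s * (β.f s X * β.g s W) := fun X W => by
    simp only [eX, LinearMap.coe_sum, Finset.sum_apply, LinearMap.smul_apply, smul_eq_mul]
    exact Finset.sum_congr rfl fun s _ => by ring
  let Xb : Fin 3 → Matrix (Fin 2) (Fin 2) k := ![single 0 0 1, single 0 1 1, single 1 0 1]
  -- `K₁` = common kernel of the `g_t` (`t ∉ O`) and of `e(E₀₀,·), e(E₀₁,·), e(E₁₀,·)`
  set Zs : Finset ι := Finset.univ \ O with hZs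
  let φ : Matrix (Fin 2) (Fin n) k →ₗ[k] (Zs → k) × (Fin 3 → k) :=
    LinearMap.prod (LinearMap.pi fun t => β.g (t : ι)) (LinearMap.pi fun i => eW (Xb i))
  set K₁ := LinearMap.ker φ with hK₁
  have memK₁ : ∀ W, W ∈ K₁ ↔ (∀ t, t ∉ O → β.g t W = 0) ∧ ∀ i, eW (Xb i) W = 0 := fun W => by
    rw [hK₁, LinearMap.mem_ker, LinearMap.prod_apply, Prod.mk_eq_zero]
    constructor
    · rintro ⟨h, h0⟩
      refine ⟨fun t ht => ?_, fun i => ?_⟩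
      · have := congr_fun h ⟨t, Finset.mem_sdiff.mpr ⟨Finset.mem_univ t, ht⟩⟩
        simpa using this
      · have := congr_fun h0 i
        simpa using this
    · rintro ⟨h, h0⟩
      refine ⟨?_, ?_⟩
      · funext t; simpa using h t (Finset.mem_sdiff.mp t.2).2
      · funext i; simpa using h0 i
  -- on `K₁` the defect vanishes at every `X`
  have he0 : ∀ W, W ∈ K₁ → ∀ X : Matrix (Fin 2) (Fin 2) k, ∑ s ∈ O, l s * (β.f s X * β.g s W) = 0 := by
    intro W hW X
    obtain ⟨hWg, hWe⟩ := (memK₁ W).mp hW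
    have h00 : eX W (single 0 0 1) = 0 := by rw [heX, ← heW]; exact hWe 0
    have h01 : eX W (single 0 1 1) = 0 := by rw [heX, ← heW]; exact hWe 1
    have h10 : eX W (single 1 0 1) = 0 := by rw [heX, ← heW]; exact hWe 2
    have h1 : eX W 1 = 0 := by rw [heX]; exact nearDefect_one β O hO hM hρ hσ hl W
    have hone : (1 : Matrix (Fin 2) (Fin 2) k) = single 0 0 1 + single 1 1 1 := by
      ext i j; fin_cases i <;> fin_cases j <;> simp
    have h11 : eX W (single 1 1 1) = 0 := by
      have h := h1
      rw [hone, map_add, h00, zero_add] at h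
      exact h
    have hX : X = X 0 0 • single 0 0 1 + X 0 1 • single 0 1 1 + X 1 0 • single 1 0 1 + X 1 1 • single 1 1 1 := by
      ext i j; fin_cases i <;> fin_cases j <;> simp
    rw [← heX, hX]
    simp only [map_add, map_smul, smul_eq_mul, h00, h01, h10, h11, mul_zero, add_zero]
  set Js : Finset (Fin n) := Finset.univ \ J with hJs
  let b : Fin 2 × Js → Matrix (Fin 2) (Fin n) k := fun p => single p.1 (p.2 : Fin n) (1 : k)
  set M₀ := Submodule.span k (Set.range b) with hM₀
  have memM₀ : ∀ W : Matrix (Fin 2) (Fin n) k, (∀ j ∈ J, ∀ i, W i j = 0) → W ∈ M₀ := by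
    intro W hW
    rw [matrix_eq_sum_single W]
    refine Submodule.sum_mem _ fun i _ => Submodule.sum_mem _ fun j _ => ?_
    by_cases hj : j ∈ J
    · rw [hW j hj i, single_zero]; exact Submodule.zero_mem _
    · have : single i j (W i j) = W i j • b (i, ⟨j, Finset.mem_sdiff.mpr ⟨Finset.mem_univ j, hj⟩⟩) := by
        simp only [b, smul_single, smul_eq_mul, mul_one]
      rw [this]
      exact Submodule.smul_mem _ _ (Submodule.subset_span ⟨_, rfl⟩)
  -- line columns of `K₁` vanish
  have hle : K₁ ≤ M₀ := fun W hW => by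
    obtain ⟨hWg, _⟩ := (memK₁ W).mp hW
    refine memM₀ W fun j hj i => ?_
    rw [nearLineCol_eq β O hO' hM hj₀ hl hl₀ (hζ j hj) (fun t ht => hT t ht j hj) (hQ j hj) hWg i, he0 W hW, mul_zero]
  -- dimensions: `dim M₀ ≤ 2(n − |J|) ≤ 4n − |ι| − 2 ≤ dim K₁`
  have hdimM : finrank k M₀ ≤ 2 * (n - J.card) := by
    calc finrank k M₀ ≤ Fintype.card (Fin 2 × Js) := finrank_range_le_card b
      _ = 2 * (n - J.card) := by
          rw [Fintype.card_prod, Fintype.card_fin, Fintype.card_coe, hJs, Finset.card_sdiff,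
            Finset.inter_univ, Finset.card_univ, Fintype.card_fin]
  have hdimK : 2 * n ≤ finrank k K₁ + (Fintype.card ι - O.card + 3) := by
    have h1 := LinearMap.finrank_range_add_finrank_ker φ
    rw [finrank_matrix_fin, ← hK₁] at h1
    have h2 : finrank k (LinearMap.range φ) ≤ Fintype.card ι - O.card + 3 := by
      calc finrank k (LinearMap.range φ) ≤ finrank k ((Zs → k) × (Fin 3 → k)) := Submodule.finrank_le _
        _ = Fintype.card ι - O.card + 3 := by
            rw [Module.finrank_prod, finrank_fintype_fun_eq_card, finrank_fintype_fun_eq_card, Fintype.card_coe, hZs,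
              Finset.card_sdiff, Finset.inter_univ, Finset.card_univ, Fintype.card_fin]
    omega
  have hOle : O.card ≤ Fintype.card ι := by
    calc O.card ≤ (Finset.univ : Finset ι).card := Finset.card_le_card (Finset.subset_univ O)
      _ = Fintype.card ι := Finset.card_univ
  have hKM : K₁ = M₀ := Submodule.eq_of_le_of_finrank_le hle (by omega)
  -- a unit matrix in a free column and its left multiples lie in `M₀ = K₁`
  have hJs_ne : Js.Nonempty := by
    rw [← Finset.card_pos, hJs, Finset.card_sdiff, Finset.inter_univ, Finset.card_univ, Fintype.card_fin]; omega
  obtain ⟨j₁, hj₁⟩ := hJs_ne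
  have hj₁J : j₁ ∉ J := (Finset.mem_sdiff.mp hj₁).2
  set W₁ : Matrix (Fin 2) (Fin n) k := single 0 j₁ 1 with hW₁
  have hK₁_of : ∀ W : Matrix (Fin 2) (Fin n) k, (∀ j ∈ J, ∀ i, W i j = 0) → W ∈ K₁ := fun W hW => hKM ▸ memM₀ W hW
  have hW₁cols : ∀ j ∈ J, ∀ i, W₁ i j = 0 := fun j hj i =>
    single_apply_of_col_ne 0 i (ne_of_mem_of_not_mem hj hj₁J).symm 1
  have hXW₁cols : ∀ X : Matrix (Fin 2) (Fin 2) k, ∀ j ∈ J, ∀ i, (X * W₁) i j = 0 := fun X j hj i =>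
    mul_single_apply_of_ne (c := (1 : k)) 0 j₁ i j (ne_of_mem_of_not_mem hj hj₁J) X
  -- exact transport on `K₁`
  have htrans : ∀ W : Matrix (Fin 2) (Fin n) k, (∀ j ∈ J, ∀ i, W i j = 0) → ∀ s ∈ O, ∀ X : Matrix (Fin 2) (Fin 2) k,
      β.f s 1 * β.g s (X * W) = β.f s X * β.g s W := by
    intro W hW s hs X
    have hK := hK₁_of W hW
    obtain ⟨hWg, _⟩ := (memK₁ W).mp hK
    rw [near_transport β O hM hWg hs X]
    have hσ' : ∑ s' ∈ O, σ s' * (β.f s' X * β.g s' W) = σ j₀ * ∑ s' ∈ O, l s' * (β.f s' X * β.g s' W) := by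
      rw [Finset.mul_sum]
      exact Finset.sum_congr rfl fun s' hs' => by rw [hl s' hs']; ring
    rw [hσ', he0 W hK X, mul_zero, mul_zero, add_zero]
  -- some `s ∈ O` sees `W₁`
  have hex : ∃ s ∈ O, β.g s W₁ ≠ 0 := by
    by_contra hall
    push Not at hall
    have h := eq_sum_off_one β O hO W₁
    have hzero : W₁ = 0 := by
      rw [h]; exact Finset.sum_eq_zero fun s hs => by rw [hall s hs, mul_zero, zero_smul]
    have : W₁ 0 j₁ = (1 : k) := single_apply_same 0 j₁ 1
    rw [hzero, Matrix.zero_apply] at this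
    exact zero_ne_one this
  obtain ⟨s, hs, hgs⟩ := hex
  refine not_mul_hom_matrix_two (β.f s) (hO' s hs) rfl fun A B => ?_
  have h1 := htrans W₁ hW₁cols s hs (A * B)
  have h2 := htrans (B * W₁) (hXW₁cols B) s hs A
  have h3 := htrans W₁ hW₁cols s hs B
  rw [Matrix.mul_assoc] at h1
  have key : β.f s (A * B) * β.f s 1 * β.g s W₁ = β.f s A * β.f s B * β.g s W₁ := by
    have e1 : β.f s 1 * (β.f s 1 * β.g s (A * (B * W₁))) = β.f s 1 * (β.f s (A * B) * β.g s W₁) := by rw [h1]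
    have e2 : β.f s 1 * (β.f s 1 * β.g s (A * (B * W₁))) = β.f s A * (β.f s 1 * β.g s (B * W₁)) := by
      rw [h2]; ring
    rw [h3] at e2
    linear_combination -e1 + e2
  exact mul_right_cancel₀ hgs key

end Wide

end Summit.MatrixMultiplication.OmegaCensus.SmallFormats
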